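import Summits.RiemannHypothesis.RiemannHypothesis.Theorems.Splittings.RobinFiniteRefl
import Summits.RiemannHypothesis.RiemannHypothesis.Theorems.Splittings.RobinFiniteKernelPsiTheta
import HarnessLib

/-!
# RobinFiniteKernelHeightCore — the `c = 1` core and the CA level `4¹¹ ≤ P ≤ X ≤ 8 886 113`, PRINT-FREE on the KERNEL `θ`-window, with gen 14's
# reflection-halved charge; the halved level-11 condition HOLDS at the kernel height `T = 10⁵` (SPLIT-robin-finite gen 15, part 2/4)

Cell rh-split, card `cards/SPLIT-robin-finite.md` §22.  HONEST LABEL: «SPLITTING SEARCH over kernel-typed RH-EQUIVALENCES; a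
splitting A ∧ B ⟹ RH is CONDITIONAL bookkeeping unless A and B are both proved; nothing here bears on the truth of RH.»

(1) The engine's `θ`-window on `[599, 8 886 113]` IS the kernel table `abs_theta_sub_le_smallRange` (`thetaWindow_kernel`; no Büthe 2016, no RH).
(2) `corePwLower1K`: the tree's core `corePwLower1` with stub S4 replaced by `RobinFiniteKernelPsiTheta.jk_partial_le_kernel`; the truncation excess
`1.62·10⁻⁸ ≤ 0.0008/(√x log x)` (`x ≤ 8 886 113`) moves the budget constant `0.0463 → 0.0471`; hypotheses = `RiemannHypothesisUpTo T` + the window +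
an off-line bound `D` ONLY.  (3) Gen 14's reflection-halved off-line bound (`RobinFiniteRefl.offLineSumAt_refl_of_zeroTailBound`, charge
`tailH(T)·(√x + 1/√x)/2`) gives the CA Mertens inequality on the NON-DYADIC window `4¹¹ ≤ P ≤ X ≤ 8 886 113` under the halved level-11 condition
`0.0471 + (1 + 2/L₁(11))·tailH(T)·(√X + 1/√X)/2 ≤ b₁₁ = 0.105` (`mertensProdLt_partial11_kernelFree`, `robinCA_below_kernelWindowFree`; smaller CA numbers by
the tree's `robinCA_below_four_pow_eleven`), and that condition HOLDS at `T = 10⁵`, `X = 8 886 113`: `0.0471 + 1.1312·3.42·10⁻⁵·1491 ≤ 0.1048 ≤ 0.105`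
(`level11_kernelFree_condition`; `tailH_1e5_le`, `√X ≤ 2981`).  Standard axioms; 0 `def`, 0 `sorry`, no named fact.  Nothing here bears on the truth of RH.
-/

set_option linter.dupNamespace false

noncomputable section

open Real Filter Finset
open scoped Chebyshev ComplexConjugate

namespace Summit.RiemannHypothesis.RiemannHypothesis.Theorems.Splittings.RobinFiniteC1

open Literature.NumberTheory.LFunctions Literature.NumberTheory.DiophantineGeometry
open RobinAnalyticSharp RobinAnalyticSharp.Cells
open NicolasJ NicolasFz NicolasK NicolasJExplicit
open Summit.RiemannHypothesis.RiemannHypothesis.Theorems.Splittings.RobinFiniteE3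
open Summit.RiemannHypothesis.RiemannHypothesis.Theorems.Splittings.RobinFiniteTail (zeroTailBound_tailH tailH_nonneg tailH_1e5_le)
open Summit.RiemannHypothesis.RiemannHypothesis.Theorems.Splittings.RobinFiniteE1c

section KernelHeightCore

open MeasureTheory

/-! ### K0 · the KERNEL `θ`-window (no Büthe 2016, no RH) and `√8886113` -/


/-- **K0 · the kernel `θ`-window**: `|θ(y) − y| ≤ √y log² y/(8π)` for `599 ≤ y ≤ 8 886 113`, unconditionally (tree
`abs_theta_sub_le_smallRange`, kernel-certified prime by prime; gen 11's `thetaWindow_low` needs Büthe 2016 Thm 2 + `RH(T)` +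
`4.92√(B/log B) ≤ T` beyond this point). -/
theorem thetaWindow_kernel :
    ∀ y : ℝ, 599 ≤ y → y ≤ 8886113 → |θ y - y| ≤ √y * Real.log y ^ 2 / (8 * π) :=
  fun _ hy hy' => abs_theta_sub_le_smallRange hy hy'

/-- `√8886113 ≤ 2981` (`2981² = 8 886 361`). -/
theorem sqrt_8886113_le : √(8886113 : ℝ) ≤ 2981 := by
  rw [Real.sqrt_le_left (by norm_num)]; norm_num

/-! ### F3 · the `c = 1` core, PRINT-FREE on the kernel window (`x ≤ 8 886 113`; budget constant `0.0471`) -/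

/-- **F3 · the core, print-free** (tree `corePwLower1 hB hK` with S4 replaced by `RobinFiniteKernelPsiTheta.jk_partial_le_kernel`): for `599 ≤ x ≤ 8 886 113`, `D ≥ 0`, RH up to `T`,
the `θ`-window on `[599, x]` and `Σ_{|γ|>T} m(ρ) x^{Re ρ − 1/2}/γ² ≤ D`:  `−log f(x) ≤ E(0.0471 + (1 + 2/log x)D, x)`
(the truncation excess `1.62·10⁻⁸ ≤ 0.0008/(√x log x)` is the `0.0008`).  Standard axioms; NO named fact. -/
theorem corePwLower1K :
    ∀ T x D : ℝ, 599 ≤ x → x ≤ 8886113 → 0 ≤ D → RiemannHypothesisUpTo T →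
      (∀ y : ℝ, 599 ≤ y → y ≤ x → |θ y - y| ≤ √y * Real.log y ^ 2 / (8 * π)) →
      (∑' ρ : RHWave0.riemannZetaNontrivialZeros,
        (if T < |(ρ : ℂ).im| then
          (riemannZetaZeroOrder (ρ : ℂ) : ℝ) * x ^ ((ρ : ℂ).re - 1 / 2) / (ρ : ℂ).im ^ 2 else 0) ≤ D) →
      -Real.log (nicolasF x) ≤ RobinAnalyticSharp.nicolasERH x +
        (0.0471 + (1 + 2 / Real.log x) * D - nicolasBeta) *
          (1 / (√x * Real.log x) + 1 / (√x * Real.log x ^ 2) + 4 / (√x * Real.log x ^ 3)) := by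
  intro T x D hx hx' hD hT hW hoff
  have hx1 : (1 : ℝ) < x := by linarith
  have hx0 : (0 : ℝ) < x := by linarith
  have hlx : 0 < Real.log x := Real.log_pos hx1
  have hsx : 0 < Real.sqrt x := Real.sqrt_pos.2 hx0
  have h21 := NicolasK.lemma21_lower (by linarith : (121 : ℝ) ≤ x) (theta_ge_four_fifths_of_window hW hx)
  have hS2 := sq_theta_sub_div_le_of_window hW hx
  obtain ⟨hsum, L, hL, hZL⟩ := explicitFormulaFree_holds x hx1
  have hK := NicolasK.tendsto_integral_S_mul_w0 hx1
  have hJK : L - nicolasKInt x ≤ 1.021 * (Fz (1 / 2 : ℝ) x).re + 4 / 3 * (Fz (1 / 3 : ℝ) x).re + 1.62e-8 := by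
    refine le_of_tendsto (hL.sub hK) ?_
    filter_upwards [eventually_ge_atTop x] with X hX
    exact jk_partial_le_kernel hx hx' hX
  have hZ := zeroSplitBound_holds T x D hx1 hT hoff hsum
  have hF2 := NicolasFz.Fhalf_le hx1
  have hF3 := NicolasFz.Fthird_le hx1
  obtain ⟨a₁, ha₁⟩ : ∃ a : ℝ, a = 1 / (Real.sqrt x * Real.log x) := ⟨_, rfl⟩
  obtain ⟨a₂, ha₂⟩ : ∃ a : ℝ, a = 1 / (Real.sqrt x * Real.log x ^ 2) := ⟨_, rfl⟩
  obtain ⟨a₃, ha₃⟩ : ∃ a : ℝ, a = 1 / (Real.sqrt x * Real.log x ^ 3) := ⟨_, rfl⟩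
  obtain ⟨a₅, ha₅⟩ : ∃ a : ℝ, a = 1 / (x ^ ((2 : ℝ) / 3) * Real.log x) := ⟨_, rfl⟩
  obtain ⟨P, hP⟩ : ∃ a : ℝ, a = (1 + 2 / Real.log x) * D := ⟨_, rfl⟩
  have hP0 : 0 ≤ P := by rw [hP]; positivity
  have ha₁0 : 0 ≤ a₁ := by rw [ha₁]; positivity
  have ha₂0 : 0 ≤ a₂ := by rw [ha₂]; positivity
  have ha₃0 : 0 ≤ a₃ := by rw [ha₃]; positivity
  have hPa₁ : 0 ≤ P * a₁ := mul_nonneg hP0 ha₁0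
  have hPa₂ : 0 ≤ P * a₂ := mul_nonneg hP0 ha₂0
  have hPa₃ : 0 ≤ P * a₃ := mul_nonneg hP0 ha₃0
  -- the truncation excess is `≤ 0.0008·a₁` on the kernel window
  have hE : (1.62e-8 : ℝ) ≤ 0.0008 * a₁ := by
    rw [ha₁]
    have hs : √x ≤ 2981 := (Real.sqrt_le_sqrt hx').trans sqrt_8886113_le
    have hl : Real.log x ≤ 16.001 := (Real.log_le_log hx0 hx').trans log_8886113_le
    have hprod : √x * Real.log x ≤ 2981 * 16.001 := mul_le_mul hs hl hlx.le (by norm_num)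
    rw [mul_one_div, le_div_iff₀ (by positivity)]
    nlinarith
  have eZ : -(0.0463 * (1 / (Real.sqrt x * Real.log x) + Dx x)
      + (1 + 2 / Real.log x) * D * (1 / (Real.sqrt x * Real.log x))) =
      -0.0463 * a₁ - 0.0463 * a₂ - 0.1852 * a₃ - P * a₁ := by
    rw [ha₁, ha₂, ha₃, hP, NicolasJExplicit.Dx]
    field_simp
    ring
  have eF2 : 2 / (Real.sqrt x * Real.log x) - 2 / (Real.sqrt x * Real.log x ^ 2) +
      8 / (Real.sqrt x * Real.log x ^ 3) = 2 * a₁ - 2 * a₂ + 8 * a₃ := by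
    rw [ha₁, ha₂, ha₃]; ring
  have eF3 : 3 / (2 * x ^ (2 / 3 : ℝ) * Real.log x) = 3 / 2 * a₅ := by
    rw [ha₅]; ring
  have eE : RobinAnalyticSharp.nicolasERH x +
        (0.0471 + (1 + 2 / Real.log x) * D - nicolasBeta) *
          (1 / (√x * Real.log x) + 1 / (√x * Real.log x ^ 2) + 4 / (√x * Real.log x ^ 3)) =
      2.0891 * a₁ + (P * a₁) - 1.9949 * a₂ + (P * a₂) + 8.3564 * a₃ + 4 * (P * a₃)
        + Real.log (2 * π) / (x * Real.log x) + 2 * a₅ + Real.log x ^ 3 / (64 * π ^ 2 * x) := by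
    rw [ha₁, ha₂, ha₃, ha₅, hP]
    unfold RobinAnalyticSharp.nicolasERH RobinAnalyticSharp.nicolasE
    ring
  rw [eZ] at hZ
  rw [eF2] at hF2
  rw [eF3] at hF3
  rw [eE]
  linarith

/-- The print-free pointwise budget `0.0471 + (1 + 2/log x)D` decreases along the window (`D ≥ 0`). -/
theorem budgetPw1K_anti {D X₀ x : ℝ} (hD : 0 ≤ D) (hX₀ : 1 < X₀) (hx : X₀ ≤ x) :
    0.0471 + (1 + 2 / Real.log x) * D ≤ 0.0471 + (1 + 2 / Real.log X₀) * D := by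
  have := budgetPw1_anti hD hX₀ hx
  linarith

/-- **F3b · windowed form** (tree `partialNicolasBetween1_holds hB hK`, print-free on a window inside `[599, 8 886 113]`). -/
theorem partialNicolasBetween1K_holds {T B D X₀ X₁ : ℝ}
    (hoff : ∀ x : ℝ, X₀ ≤ x → x ≤ X₁ →
      ∑' ρ : RHWave0.riemannZetaNontrivialZeros,
        (if T < |(ρ : ℂ).im| then
          (riemannZetaZeroOrder (ρ : ℂ) : ℝ) * x ^ ((ρ : ℂ).re - 1 / 2) / (ρ : ℂ).im ^ 2 else 0) ≤ D)
    (hD : 0 ≤ D) (hX₀ : 1 < X₀) (hBB : X₁ ≤ B) (hB8 : B ≤ 8886113) :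
    RiemannHypothesisUpTo T → (∀ y : ℝ, 599 ≤ y → y ≤ B → |θ y - y| ≤ √y * Real.log y ^ 2 / (8 * π)) →
      ∀ x : ℝ, 599 ≤ x → X₀ ≤ x → x ≤ X₁ →
        -Real.log (nicolasF x) ≤ RobinAnalyticSharp.nicolasERH x +
            (0.0471 + (1 + 2 / Real.log X₀) * D - nicolasBeta) *
              (1 / (√x * Real.log x) + 1 / (√x * Real.log x ^ 2) + 4 / (√x * Real.log x ^ 3)) := by
  intro hT hθ x hx hx0 hx1
  have h := corePwLower1K T x D hx (hx1.trans (hBB.trans hB8)) hD hT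
    (fun y hy hyx => hθ y hy (le_trans hyx (le_trans hx1 hBB))) (hoff x hx0 hx1)
  exact h.trans (nicolasEWith_mono (by linarith) (budgetPw1K_anti hD hX₀ hx0))

/-- `a + a⁻¹ ≤ b + b⁻¹` for `1 ≤ a ≤ b` (`u ↦ u + 1/u` is increasing on `[1, ∞)`; private copy — the public statement is the
landed `SignConeOscillatory.Negative.OriginDominatingNumerics.add_inv_le_add_inv`, and lane (ix-h) #2 keeps its own private copy). -/
private theorem add_inv_le_add_inv {a b : ℝ} (ha : 1 ≤ a) (hab : a ≤ b) : a + a⁻¹ ≤ b + b⁻¹ := by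
  have ha0 : 0 < a := by linarith
  have hb0 : 0 < b := by linarith
  rw [← sub_nonneg]
  have e : b + b⁻¹ - (a + a⁻¹) = (b - a) * (1 - 1 / (a * b)) := by
    field_simp
    ring
  rw [e]
  refine mul_nonneg (by linarith) ?_
  rw [sub_nonneg, div_le_one (mul_pos ha0 hb0)]
  nlinarith

/-- **F3c · with a tail bound `Σ_{|γ|>T} m/γ² ≤ h` and the REFLECTION-halved charge** (gen 14 `partialNicolasBetween1_refl_of_tail`,
print-free): budget `0.0471 + (1 + 2/log X₀)·h·(√X₁ + 1/√X₁)/2` on `[X₀, X₁] ⊆ [599, B]`, `B ≤ 8 886 113`. -/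
theorem partialNicolasBetween1K_refl_of_tail {T B h X₀ X₁ : ℝ}
    (ht : ∑' ρ : RHWave0.riemannZetaNontrivialZeros,
        (if T < |(ρ : ℂ).im| then (riemannZetaZeroOrder (ρ : ℂ) : ℝ) / (ρ : ℂ).im ^ 2 else 0) ≤ h)
    (hh : 0 ≤ h) (hX₀ : 1 < X₀) (hBB : X₁ ≤ B) (hB8 : B ≤ 8886113) :
    RiemannHypothesisUpTo T → (∀ y : ℝ, 599 ≤ y → y ≤ B → |θ y - y| ≤ √y * Real.log y ^ 2 / (8 * π)) →
      ∀ x : ℝ, 599 ≤ x → X₀ ≤ x → x ≤ X₁ →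
        -Real.log (nicolasF x) ≤ RobinAnalyticSharp.nicolasERH x +
            (0.0471 + (1 + 2 / Real.log X₀) * (h * ((√X₁ + (√X₁)⁻¹) / 2)) - nicolasBeta) *
              (1 / (√x * Real.log x) + 1 / (√x * Real.log x ^ 2) + 4 / (√x * Real.log x ^ 3)) := by
  refine partialNicolasBetween1K_holds (fun x hx0 hx1 => ?_) (by positivity) hX₀ hBB hB8
  have hx1' : 1 ≤ x := by linarith
  refine le_trans (offLineSumAt_refl_of_zeroTailBound ht hx1') (mul_le_mul_of_nonneg_left ?_ hh)
  have hs1 : 1 ≤ √x := by rw [← Real.sqrt_one]; exact Real.sqrt_le_sqrt hx1'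
  have := add_inv_le_add_inv hs1 (Real.sqrt_le_sqrt hx1)
  linarith

/-- **F3d · with the KERNEL's tail price `tailH(T)`**, any `T ≥ 7` (print-free). -/
theorem partialNicolasBetween1K_refl_tailFree {T B X₀ X₁ : ℝ} (hT : 7 ≤ T) (hX₀ : 1 < X₀) (hBB : X₁ ≤ B) (hB8 : B ≤ 8886113) :
    RiemannHypothesisUpTo T → (∀ y : ℝ, 599 ≤ y → y ≤ B → |θ y - y| ≤ √y * Real.log y ^ 2 / (8 * π)) →
      ∀ x : ℝ, 599 ≤ x → X₀ ≤ x → x ≤ X₁ →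
        -Real.log (nicolasF x) ≤ RobinAnalyticSharp.nicolasERH x +
            (0.0471 + (1 + 2 / Real.log X₀) *
              (((Real.log (T / (2 * π)) + 1) / (π * T) + (184 + 30 * Real.log T) / T ^ 2) * ((√X₁ + (√X₁)⁻¹) / 2)) - nicolasBeta) *
              (1 / (√x * Real.log x) + 1 / (√x * Real.log x ^ 2) + 4 / (√x * Real.log x ^ 3)) :=
  partialNicolasBetween1K_refl_of_tail (zeroTailBound_tailH hT) (tailH_nonneg hT) hX₀ hBB hB8

/-- **F3e · the pointwise lower bound at height `T`, halved and PRINT-FREE** (gen 14 `negLog_le_Eb_point_refl hB hK`):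
`−log f(P) ≤ Eb(0.0471 + (1 + 2/log P)·tailH(T)·(√P + 1/√P)/2)(P)` for `599 ≤ P ≤ B ≤ 8 886 113`. -/
theorem negLog_le_Eb_point_reflK {T B P : ℝ} (hT : 7 ≤ T) (hRH : RiemannHypothesisUpTo T)
    (hW : ∀ y : ℝ, 599 ≤ y → y ≤ B → |θ y - y| ≤ √y * Real.log y ^ 2 / (8 * π))
    (hP : 599 ≤ P) (hPB : P ≤ B) (hB8 : B ≤ 8886113) :
    -Real.log (nicolasF P) ≤ RobinAnalyticSharp.nicolasERH P +
        (0.0471 + (1 + 2 / Real.log P) *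
          (((Real.log (T / (2 * π)) + 1) / (π * T) + (184 + 30 * Real.log T) / T ^ 2) * ((√P + (√P)⁻¹) / 2)) - nicolasBeta) *
          (1 / (√P * Real.log P) + 1 / (√P * Real.log P ^ 2) + 4 / (√P * Real.log P ^ 3)) :=
  partialNicolasBetween1K_refl_tailFree (X₀ := P) (X₁ := P) hT (by linarith) hPB hB8 hRH hW P hP le_rfl le_rfl

/-! ### F4 · the partial level `4¹¹ ≤ P ≤ X ≤ 8 886 113`, PRINT-FREE, and the kernel-height numerics with `0.0471` -/

/-- **F4a · the CA Mertens inequality on `4¹¹ ≤ P ≤ X ≤ 8 886 113` at any `T ≥ 7` with `RH(T)`, PRINT-FREE**, under the halved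
level-11 condition with the constant `0.0471` (the untruncated engine with {Büthe 2018, BKLNW} as hypotheses would give `0.0463`,
cf. `RobinFiniteReflLow.mertensProdLt_level_refl`). -/
theorem mertensProdLt_partial11_kernelFree
    {T : ℝ} (hT : 7 ≤ T) (hRH : RiemannHypothesisUpTo T) {X : ℝ} (hX : X ≤ 8886113)
    (hlev : 0.0471 + (1 + 2 / ((L1 11 : ℚ) : ℝ)) *
      (((Real.log (T / (2 * π)) + 1) / (π * T) + (184 + 30 * Real.log T) / T ^ 2) * ((√X + (√X)⁻¹) / 2)) ≤ ((bk 11 : ℚ) : ℝ))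
    {P Q : ℕ} (hPl : 4 ^ 11 ≤ P) (hPX : (P : ℝ) ≤ X) (hQP : Q ≤ P) :
    (∏ p ∈ Nat.primesLE P, (1 - (p : ℝ)⁻¹))⁻¹ *
        ∏ p ∈ (Nat.primesLE P).filter (fun p => Q < p), (1 - ((p : ℝ) ^ 2)⁻¹) <
      rexp eulerMascheroniConstant * Real.log (θ P + θ Q) := by
  have ht0 := tailH_nonneg hT
  obtain ⟨hP₁599, hL₁, -, -, hL₁8, -, -⟩ := range_facts (k := 11) (by norm_num)
  have hPr : (4 : ℝ) ^ 11 ≤ P := by exact_mod_cast hPl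
  have hP599 : (599 : ℝ) ≤ P := hP₁599.trans hPr
  have hPB : (P : ℝ) ≤ 8886113 := hPX.trans hX
  have hPu : P ≤ 4 ^ (11 + 1) := by
    have h : (P : ℝ) ≤ (4 : ℝ) ^ (11 + 1) := hPB.trans (by norm_num)
    exact_mod_cast h
  have hW := thetaWindow_kernel
  have hlow := negLog_le_Eb_point_reflK hT hRH hW hP599 hPB le_rfl
  have hL₁0 : (0 : ℝ) < ((L1 11 : ℚ) : ℝ) := by linarith
  have hfac0 : (0 : ℝ) ≤ 2 / ((L1 11 : ℚ) : ℝ) := by positivity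
  have hlogP : ((L1 11 : ℚ) : ℝ) ≤ Real.log P := hL₁.trans (Real.log_le_log (by positivity) hPr)
  have h2 : 2 / Real.log (P : ℝ) ≤ 2 / ((L1 11 : ℚ) : ℝ) := div_le_div_of_nonneg_left (by norm_num) hL₁0 hlogP
  have h2' : (0 : ℝ) ≤ 2 / Real.log (P : ℝ) := div_nonneg (by norm_num) (hL₁0.le.trans hlogP)
  have hsP1 : 1 ≤ √(P : ℝ) := by rw [← Real.sqrt_one]; exact Real.sqrt_le_sqrt (by linarith)
  have hsP : √(P : ℝ) ≤ √X := Real.sqrt_le_sqrt hPX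
  set t : ℝ := ((Real.log (T / (2 * π)) + 1) / (π * T) + (184 + 30 * Real.log T) / T ^ 2) with ht_def
  have hch : (√(P : ℝ) + (√(P : ℝ))⁻¹) / 2 ≤ (√X + (√X)⁻¹) / 2 := by
    have := add_inv_le_add_inv hsP1 hsP; linarith
  have hch0 : 0 ≤ (√(P : ℝ) + (√(P : ℝ))⁻¹) / 2 := by positivity
  have h3 : t * ((√(P : ℝ) + (√(P : ℝ))⁻¹) / 2) ≤ t * ((√X + (√X)⁻¹) / 2) := mul_le_mul_of_nonneg_left hch ht0
  have h4 : (1 + 2 / Real.log (P : ℝ)) * (t * ((√(P : ℝ) + (√(P : ℝ))⁻¹) / 2)) ≤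
      (1 + 2 / ((L1 11 : ℚ) : ℝ)) * (t * ((√X + (√X)⁻¹) / 2)) :=
    mul_le_mul (by linarith) h3 (mul_nonneg ht0 hch0) (by linarith)
  have hbud : 0.0471 + (1 + 2 / Real.log (P : ℝ)) * (t * ((√(P : ℝ) + (√(P : ℝ))⁻¹) / 2)) ≤ ((bk 11 : ℚ) : ℝ) := by
    linarith
  have hkey := key_ineq_levelB hW (k := 11) le_rfl (by norm_num) hPl hPu hPB hQP hbud
  exact mertens_prod_lt_of hW hPl hPB hlow hkey

open scoped ArithmeticFunction.sigma in
/-- **F4b · RH(T) (`T ≥ 7`) ALONE ⟹ Robin at every colossally abundant `N > 5040` all of whose primes are `≤ X`**, for every natural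
`X ≤ 8 886 113` passing the halved level-11 condition with `0.0471`; CA numbers with a prime in `(4¹¹, X]` by `key_ineq_levelB`
(`k = 11`) + `mertens_prod_lt_of`, the others by the tree's `robinCA_below_four_pow_eleven`. -/
theorem robinCA_below_kernelWindowFree
    {T : ℝ} (hT : 7 ≤ T) (hRH : RiemannHypothesisUpTo T) {X : ℕ} (hX : (X : ℝ) ≤ 8886113)
    (hlev : 0.0471 + (1 + 2 / ((L1 11 : ℚ) : ℝ)) *
      (((Real.log (T / (2 * π)) + 1) / (π * T) + (184 + 30 * Real.log T) / T ^ 2) * ((√(X : ℝ) + (√(X : ℝ))⁻¹) / 2)) ≤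
        ((bk 11 : ℚ) : ℝ)) :
    robinCA_below (X + 1) := by
  intro N hCA h5040 hprimes
  obtain ⟨ε, P, Q, -, -, hP, hPN, -, hQP, hpf, -, -, hσ, hθ, -⟩ := hCA.exists_structure
  by_cases hsmall : P < 4 ^ 11
  · refine robinCA_below_four_pow_eleven N hCA h5040 fun p hp hpN => lt_of_le_of_lt ?_ hsmall
    have hN0 : N ≠ 0 := by omega
    have : p ∈ N.primeFactors := Nat.mem_primeFactors.2 ⟨hp, hpN, hN0⟩
    rw [hpf] at this
    exact (Nat.mem_primesLE.1 this).1
  · rw [not_lt] at hsmall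
    have hPX : (P : ℝ) ≤ X := by
      have := hprimes P hP hPN
      exact_mod_cast Nat.lt_succ_iff.1 this
    have hlt := mertensProdLt_partial11_kernelFree hT hRH hX hlev hsmall hPX hQP
    have hN0 : N ≠ 0 := by omega
    have hNpos : (0 : ℝ) < N := by exact_mod_cast Nat.pos_of_ne_zero hN0
    have hθpos : 0 < θ P + θ Q := by
      have h1 : 0 < θ (P : ℝ) := Chebyshev.theta_pos (by exact_mod_cast hP.two_le)
      have h2 : 0 ≤ θ (Q : ℝ) := Chebyshev.theta_nonneg _
      linarith
    have hlog : Real.log (θ P + θ Q) ≤ Real.log (Real.log N) := Real.log_le_log hθpos hθ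
    have hlt' : (σ 1 N : ℝ) / N < rexp eulerMascheroniConstant * Real.log (Real.log N) :=
      lt_of_le_of_lt hσ (hlt.trans_le (mul_le_mul_of_nonneg_left hlog (Real.exp_pos _).le))
    unfold robinInequality
    rw [div_lt_iff₀ hNpos] at hlt'
    linarith

/-- **F4c · the halved level-11 condition with the print-free constant `0.0471` HOLDS at the kernel height `T = 10⁵`, `X = 8 886 113`**:
`0.0471 + 1.1312·3.42·10⁻⁵·1491 ≤ 0.0471 + 0.0577 = 0.1048 ≤ b₁₁ = 0.105` (margin `2·10⁻⁴`). -/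
theorem level11_kernelFree_condition :
    0.0471 + (1 + 2 / ((L1 11 : ℚ) : ℝ)) *
      (((Real.log (100000 / (2 * π)) + 1) / (π * 100000) + (184 + 30 * Real.log 100000) / 100000 ^ 2) *
        ((√((8886113 : ℕ) : ℝ) + (√((8886113 : ℕ) : ℝ))⁻¹) / 2)) ≤ ((bk 11 : ℚ) : ℝ) := by
  have ht := tailH_1e5_le
  have ht0 := tailH_nonneg (T := 100000) (by norm_num)
  have hL : (1 + 2 / ((L1 11 : ℚ) : ℝ)) ≤ 1.1312 := by simp only [L1, l2]; push_cast; norm_num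
  have hL0 : (0 : ℝ) ≤ 1 + 2 / ((L1 11 : ℚ) : ℝ) := by simp only [L1, l2]; push_cast; norm_num
  have hbk : ((bk 11 : ℚ) : ℝ) = 0.105 := by norm_num [bk]
  have hc : ((8886113 : ℕ) : ℝ) = 8886113 := by norm_num
  rw [hbk, hc]
  have hs := sqrt_8886113_le
  have hs1 : 1 ≤ √(8886113 : ℝ) := by rw [← Real.sqrt_one]; exact Real.sqrt_le_sqrt (by norm_num)
  have hsi : (√(8886113 : ℝ))⁻¹ ≤ 1 := inv_le_one_of_one_le₀ hs1
  have hch : (√(8886113 : ℝ) + (√(8886113 : ℝ))⁻¹) / 2 ≤ 1491 := by linarith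
  have hch0 : 0 ≤ (√(8886113 : ℝ) + (√(8886113 : ℝ))⁻¹) / 2 := by positivity
  set t : ℝ := ((Real.log (100000 / (2 * π)) + 1) / (π * 100000) + (184 + 30 * Real.log 100000) / 100000 ^ 2) with ht_def
  have h1 : t * ((√(8886113 : ℝ) + (√(8886113 : ℝ))⁻¹) / 2) ≤ 3.42e-5 * 1491 :=
    mul_le_mul ht hch hch0 (by norm_num)
  have h10 : 0 ≤ t * ((√(8886113 : ℝ) + (√(8886113 : ℝ))⁻¹) / 2) := mul_nonneg ht0 hch0
  have h2 : (1 + 2 / ((L1 11 : ℚ) : ℝ)) * (t * ((√(8886113 : ℝ) + (√(8886113 : ℝ))⁻¹) / 2)) ≤ 1.1312 * (3.42e-5 * 1491) :=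
    mul_le_mul hL h1 h10 (by norm_num)
  have h3 : (1.1312 : ℝ) * (3.42e-5 * 1491) ≤ 0.0577 := by norm_num
  linarith

end KernelHeightCore

end Summit.RiemannHypothesis.RiemannHypothesis.Theorems.Splittings.RobinFiniteC1

end
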